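import Summits.BirchSwinnertonDyer.BirchSwinnertonDyer.Theorems.AlignedTransportAtTwoMainConjectureOfRankZeroBSDAtTwoCubicTowerGrowth
import Literature.NumberTheory.IwasawaTheory.ClassicalMuVanishesUnitNormIndexTrivialBase
import HarnessLib

/-!
# Route `AlignedTransportAtTwo`, crux C2 `MainConjectureOfRankZeroBSDAtTwo` (stmt-BirchSwinnertonDyer-22298):
# on the Kilford (split) stratum with ODD class number the unit norm index of EVERY layer `K_{n+1}/K_n` stays below Chevalley's maximum —
# two independent non-norm units never exist, so no order-form unit door can fire there (the `hgen`-free door of att-p3 g39 + att-p3 g25's growth law)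

HONEST FRAMING (cell `bsd-f1-sign2`, WIDTH-5 attached prover seat `bsd-line-att-p3` gen 39 on line `birth` of the lead `bsd-line-att-p2`;
`--supports` stmt-BirchSwinnertonDyer-22298, closes nothing; BSD is NOT proved by any of this; the crux C2, its verdict «blocked-on
`Rank1Residual.GreenbergMuConjectureIrreducible`» and every registered stub are untouched).  THEOREMS ONLY — no definition, no named fact, no
`sorry`; every arithmetic input is a DISPLAYED hypothesis, in the currency of `…CubicTowerGrowth` (att-p3 g25) and of
`Literature/…/ClassicalMuVanishesUnitNormIndexTrivialBase` (att-p3 g39).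

WHY.  `K` a number field of odd degree and unit rank `1` (a complex cubic field) in which every prime above `2` has odd absolute ramification
index and at least THREE primes lie above `2` (the cell's `Δ_W ≡ 1 (mod 8)` stratum: `2` splits completely in `ℚ(β)`; all twelve certified
seeds); `κ` a cyclotomic `ℤ₂`-extension.  att-p3 g25 proved `e_0 + n ≤ e_n + 1` at every layer (`classNumberPExp_zero_add_le_layer_of_three_le`):
the `2`-class numbers are unbounded.  att-p3 g39 proved that, when moreover `2 ∤ h_K`, Chevalley's unit input at ONE layer `K_{n+1}/K_n` — at most
`s` ramified primes and `2^s ∣ [E_{K_n} : E_{K_n} ∩ N K_{n+1}ˣ] · 2` — forces `e_m = e_n` for all `m ≥ n`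
(`classNumberPExp_eq_of_le_of_pow_dvd_relIndex_mul_of_not_dvd`, no generation hypothesis).  The two are incompatible:

* `not_pow_dvd_relIndex_mul_layer_of_three_le` — under g25's hypotheses and `2 ∤ h_K`, for every layer `n` and every `s` bounding the number
  of primes of `K_n` ramified in `K_{n+1}`: **`¬ 2^s ∣ [E_{K_n} : E_{K_n} ∩ N K_{n+1}ˣ] · 2`**, i.e. the unit norm index of the layer is at most
  `2^{s-2}`;
* `not_two_nonNorm_units_layer_of_three_le` — with at most three ramified primes: there are NO units `x, y` of `K_n` with `x, y, xy ∉ N K_{n+1}ˣ`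
  (tree `four_dvd_relIndex_unitsNorm_of_not_mem`).

READING for the planner-of-record / data seats: on the split stratum (with `h(ℚ(β))` odd) do not look for two non-norm units at any layer — by this
file they do not exist; the `μ₂ = 0` certificate there is Fukuda's RANK form (att-p5 g25 `…CubicLayerOneDoors`), a class-group or genus datum.
On the `Δ_W ≡ 5 (mod 8)` stratum (two primes above `2`) ONE non-norm unit of a layer suffices (`ClassicalMuVanishesOddDiscrUnitDoorsTwoTrivialBase`).

References: [Lang1990] Ch. 13 §4, Lemma 4.1–4.2 (PDF pp. 203–204); [Washington1997] §13.3 Prop. 13.22; [Fukuda1994] Thm. 1 (1), p. 264; tree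
`…CubicTowerGrowth` (att-p3 g25), `ClassicalMuVanishesUnitNormIndexTrivialBase` (att-p3 g39).
-/

set_option linter.dupNamespace false
set_option autoImplicit false

noncomputable section

open scoped Classical NumberField nonZeroDivisors

namespace Summit.BirchSwinnertonDyer.BirchSwinnertonDyer.Theorems.AlignedTransportAtTwoSplitStratumUnitIndexBound

open NumberField IsDedekindDomain
open Literature.NumberTheory.NumberFields Literature.NumberTheory.NumberFields.AmbiguousClass
  Literature.NumberTheory.GaloisRepresentations
  Literature.NumberTheory.GaloisRepresentations.Herbrand Literature.NumberTheory.GaloisRepresentations.MinkowskiUnit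
  Literature.NumberTheory.GaloisRepresentations.CyclicNormIndex Literature.NumberTheory.IwasawaTheory
  Literature.NumberTheory.EllipticCurves
  Summit.BirchSwinnertonDyer.BirchSwinnertonDyer.Theorems.AlignedTransportAtTwoCubicTowerGrowth

variable {K : Type} [Field K] [NumberField K] (κ : ZpExtension K 2) (n : ℕ) [NumberField (κ.layer n)]
  [Algebra (κ.layer n) (κ.layer (n + 1))] [IsScalarTower K (κ.layer n) (κ.layer (n + 1))]
  [FiniteDimensional K (κ.layer (n + 1))] [FiniteDimensional (κ.layer n) (κ.layer (n + 1))]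

/-- **On the split stratum with odd class number, the unit norm index of every layer is below Chevalley's maximum.**  `K` of odd degree and
unit rank `1`, `2 ∤ h_K`, every prime above `2` of odd absolute ramification index, at least three primes above `2`; `κ` a cyclotomic
`ℤ₂`-extension, `K_{n+1}/K_n` a layer (a `K_n`-algebra compatibly with `K`) with at most `s` ramified primes.  Then `2^s ∤ [E_{K_n} : E_{K_n} ∩ N K_{n+1}ˣ] · 2`:
otherwise `e_m = e_n` for all `m ≥ n` (att-p3 g39, `classNumberPExp_eq_of_le_of_pow_dvd_relIndex_mul_of_not_dvd`, Fukuda's index `0` by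
`totallyRamifiedFrom_zero_of_forall_odd_ramificationIdx`), against `e_0 + m ≤ e_m + 1` for all `m` (att-p3 g25).
[cite: Lang1990, Ch. 13 §4, Lemma 4.1–4.2 (PDF pp. 203–204)] [cite: Fukuda1994, Thm. 1 (1), p. 264] -/
theorem not_pow_dvd_relIndex_mul_layer_of_three_le (hK2 : ¬ 2 ∣ Module.finrank ℚ K) (hrank : Units.rank K = 1)
    (hh : ¬ 2 ∣ classNumber K) (hκ : κ.IsCyclotomic)
    (hodd : ∀ w : HeightOneSpectrum (𝓞 K), ((2 : ℕ) : 𝓞 K) ∈ w.asIdeal → Odd (w.asIdeal.ramificationIdx ℤ))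
    (h3 : 3 ≤ {w : HeightOneSpectrum (𝓞 K) | ((2 : ℕ) : 𝓞 K) ∈ w.asIdeal}.ncard) {s : ℕ}
    (hs : {w : HeightOneSpectrum (𝓞 (κ.layer n)) |
        w.asIdeal.ramificationIdxIn (𝓞 (κ.layer (n + 1))) ≠ 1}.ncard ≤ s) :
    ¬ 2 ^ s ∣ (unitsE (κ.layer (n + 1)) ⊓ (⊤ : Subgroup (κ.layer (n + 1))ˣ).map
          (Herbrand.norm (κ.layer (n + 1) ≃ₐ[κ.layer n] κ.layer (n + 1)))).relIndex
        (unitsE (κ.layer (n + 1)) ⊓ (unitsIncl (κ.layer n) (κ.layer (n + 1))).range) * 2 := by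
  intro hidx
  have hram : TotallyRamifiedFrom κ 0 := totallyRamifiedFrom_zero_of_forall_odd_ramificationIdx hK2 κ hκ hodd
  have hconst := classNumberPExp_eq_of_le_of_pow_dvd_relIndex_mul_of_not_dvd κ hram hh n (Nat.zero_le n) hs hidx
    (m := classNumberPExp κ n + n + 2) (by omega)
  have hgrow := classNumberPExp_zero_add_le_layer_of_three_le hK2 hrank κ hκ hodd h3 (classNumberPExp κ n + n + 2)
  omega

/-- **No two independent non-norm units on the split stratum.**  Under the same hypotheses, if at most three primes of `K_n` ramify in
`K_{n+1}`, there are no units `x, y` of `K_n` (inside `K_{n+1}ˣ`) with `x`, `y` and `xy` all outside `N K_{n+1}ˣ` — such a pair would give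
`4 ∣ [E_{K_n} : E_{K_n} ∩ N K_{n+1}ˣ]` (`four_dvd_relIndex_unitsNorm_of_not_mem`), i.e. `2^3 ∣ index · 2`.  So the two-unit door
(`classNumberPExp_succ_eq_two_of_two_nonNorm_units_of_not_dvd`, and g38's `…_of_sup_eq_top` form) is void on this stratum; its `μ₂ = 0`
certificate is Fukuda's rank form. [cite: Lang1990, Ch. 13 §4, Lemma 4.1–4.2 (PDF pp. 203–204)] [cite: Fukuda1994, Thm. 1 (1), p. 264] -/
theorem not_two_nonNorm_units_layer_of_three_le (hK2 : ¬ 2 ∣ Module.finrank ℚ K) (hrank : Units.rank K = 1)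
    (hh : ¬ 2 ∣ classNumber K) (hκ : κ.IsCyclotomic)
    (hodd : ∀ w : HeightOneSpectrum (𝓞 K), ((2 : ℕ) : 𝓞 K) ∈ w.asIdeal → Odd (w.asIdeal.ramificationIdx ℤ))
    (h3 : 3 ≤ {w : HeightOneSpectrum (𝓞 K) | ((2 : ℕ) : 𝓞 K) ∈ w.asIdeal}.ncard)
    (hs : {w : HeightOneSpectrum (𝓞 (κ.layer n)) |
        w.asIdeal.ramificationIdxIn (𝓞 (κ.layer (n + 1))) ≠ 1}.ncard ≤ 3) {x y : (κ.layer (n + 1))ˣ}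
    (hxE : x ∈ unitsE (κ.layer (n + 1)) ⊓ (unitsIncl (κ.layer n) (κ.layer (n + 1))).range)
    (hyE : y ∈ unitsE (κ.layer (n + 1)) ⊓ (unitsIncl (κ.layer n) (κ.layer (n + 1))).range)
    (hxN : x ∉ (⊤ : Subgroup (κ.layer (n + 1))ˣ).map
        (Herbrand.norm (κ.layer (n + 1) ≃ₐ[κ.layer n] κ.layer (n + 1))))
    (hyN : y ∉ (⊤ : Subgroup (κ.layer (n + 1))ˣ).map
        (Herbrand.norm (κ.layer (n + 1) ≃ₐ[κ.layer n] κ.layer (n + 1)))) :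
    x * y ∈ (⊤ : Subgroup (κ.layer (n + 1))ˣ).map
        (Herbrand.norm (κ.layer (n + 1) ≃ₐ[κ.layer n] κ.layer (n + 1))) := by
  by_contra hxyN
  haveI : FiniteDimensional K (κ.layer n) := κ.finiteDimensional_layer_holds n
  haveI : IsGalois K (κ.layer (n + 1)) := κ.isGalois_layer_holds (n + 1)
  haveI : IsGalois (κ.layer n) (κ.layer (n + 1)) := IsGalois.tower_top_of_isGalois K _ _
  haveI : NumberField (κ.layer (n + 1)) := NumberField.of_module_finite K (κ.layer (n + 1))
  haveI : Module.Free (κ.layer n) (κ.layer (n + 1)) := Module.Free.of_divisionRing _ _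
  have hdeg : Module.finrank (κ.layer n) (κ.layer (n + 1)) = 2 := by
    have h := Module.finrank_mul_finrank K (κ.layer n) (κ.layer (n + 1))
    rw [κ.finrank_layer_holds n, κ.finrank_layer_holds (n + 1), pow_succ] at h
    exact Nat.eq_of_mul_eq_mul_left (pow_pos Nat.prime_two.pos n) h
  obtain ⟨k, hk⟩ := four_dvd_relIndex_unitsNorm_of_not_mem hdeg hxE hyE hxN hyN hxyN
  refine not_pow_dvd_relIndex_mul_layer_of_three_le κ n hK2 hrank hh hκ hodd h3 hs ⟨k, ?_⟩
  rw [hk]; ring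

end Summit.BirchSwinnertonDyer.BirchSwinnertonDyer.Theorems.AlignedTransportAtTwoSplitStratumUnitIndexBound

end
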